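import Mathlib
import Summits.AtomisticToContinuum.Crystallization.Theses.BraggSlacknessRigidity
import Summits.AtomisticToContinuum.Crystallization.Theorems.ThreeConeCertificateCertificateBound
import Summits.AtomisticToContinuum.Crystallization.Theorems.BraggSlacknessRigiditySlacknessTransferFourier
import Literature.MathematicalPhysics.StatisticalMechanics.LennardJonesClusters
import Literature.MathematicalPhysics.StatisticalMechanics.CrystallizationSymmetries

/-!
# Two-sided complementary slackness: a strict certificate feeds ground states into
# hcp diffraction rigidity (route `BraggSlacknessRigidity`, item `stmt-AtomisticToContinuum-13170`)

`slacknessTransfer_proof : BraggSlacknessRigidity.SlacknessTransfer`, i.e.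
`StrictCertificate → TrialStateUpper → LennardJonesMinimalDistance → HcpDiffractionRigidity →
IsCrystallizing lennardJones 3`.

PROOF (finite `N`, two-sided complementary slackness of an exact LP-type certificate; the reading
of Cohn–Kumar 2007 §9 / Sütő 2005 / Torquato–Stillinger 2008, here as bookkeeping).  Let
`(P, ρ, c, g, U, f)` be a strict certificate and `x^N` ground states.  Since `x^N` is injective,
`V_LJ = g + U + f` termwise, and
`E(N) − N·e(P) = [𝓔_g(x^N) + cN] + [𝓔_U(x^N)] + [𝓔_f(x^N) + N f(0)/2]`
with three non-negative brackets (stability of `g`, `U ≥ 0`, the Bochner form with `w ≡ 1`: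
`∑ᵢ∑ⱼ f(|xᵢ − xⱼ|) = N f(0) + 2𝓔_f ≥ 0`), while `TrialStateUpper` at `Q = P` gives
`E(N) ≤ (e(P) + ε)N` eventually (`slack_bounds`, `eventually_energy_le`).  Hence
`𝓔_U(x^N) ≤ εN` and `∑ᵢ∑ⱼ f(|xᵢ − xⱼ|) ≤ 2εN` eventually, for every `ε > 0`.

* (S2) `U` is continuous and positive on the compact set
  `K = [δ, R] ∩ {r : η ≤ |r − d| for all d ∈ D_P}` (`U(r) = 0 ⇒ r ∈ D_P`), so `U ≥ m > 0` on `K`;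
  every counted ordered pair has its distance in `K` (hard core `δ` from
  `LennardJonesMinimalDistance`), whence `m · #pairs ≤ ∑_{i ≠ j} U = 2𝓔_U ≤ 2εN`
  (`card_filter_mul_le`).
* (S3) Fourier inversion for the continuous integrable `F = f ∘ ‖·‖` with integrable `𝓕F`
  (`Continuous.fourierInv_fourier_eq`) gives
  `∑ᵢ∑ⱼ F(xᵢ − xⱼ) = ∫ 𝓕F(ξ) |∑ⱼ e^{2πi⟨ξ,xⱼ⟩}|² dξ` (`sum_sum_eq_integral_fourier`, sibling file
  `BraggSlacknessRigiditySlacknessTransferFourier.lean`); `Re 𝓕F` is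
  continuous, `≥ 0`, and `> 0` on the compact `tsupport h` (there `𝓕F ≠ 0` by strictness), so
  `Re 𝓕F ≥ m > 0` on `tsupport h` and `|∫ h |S_N|²| ≤ (‖h‖_∞/m) ∫ Re 𝓕F |S_N|² ≤ (‖h‖_∞/m) 2εN`.

`HcpDiffractionRigidity` applied to the certificate's hcp template then returns exactly the
conclusion of `IsCrystallizing`.
-/

noncomputable section

namespace Summit.AtomisticToContinuum.Crystallization.Theorems

open Summit.AtomisticToContinuum.Crystallization.Theses
open Literature.MathematicalPhysics.StatisticalMechanics
open MeasureTheory Filter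
open scoped BigOperators Topology FourierTransform RealInnerProductSpace ComplexConjugate

namespace BraggSlacknessTransfer

/-! ## Slack bounds from the certificate -/

/-- **Complementary slackness, finite `N`.** For a three-cone split `V = g + U + f` on `(0,∞)`
(`U ≥ 0`, `f` of positive type, `g` `c`-stable) with `c + f(0)/2 = -e`, an injective
configuration with `𝓔_V(x) ≤ (e + ε)N` has `𝓔_U(x) ≤ εN` and `∑ᵢ∑ⱼ f(|xᵢ - xⱼ|) ≤ 2εN`.
[folklore] -/
theorem slack_bounds {V g U f : ℝ → ℝ} {c e : ℝ}
    (hsplit : ∀ r : ℝ, 0 < r → V r = g r + U r + f r)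
    (hU : ∀ r : ℝ, 0 < r → 0 ≤ U r)
    (hf : ∀ (n : ℕ) (y : Fin n → EuclideanSpace ℝ (Fin 3)) (w : Fin n → ℝ),
      0 ≤ ∑ i, ∑ j, w i * w j * f (dist (y i) (y j)))
    (hstab : ∀ (N : ℕ) (x : Fin N → EuclideanSpace ℝ (Fin 3)), Function.Injective x →
      -(c * (N : ℝ)) ≤ interactionEnergy g x)
    (hc : c + f 0 / 2 = -e)
    {N : ℕ} {x : Fin N → EuclideanSpace ℝ (Fin 3)} (hx : Function.Injective x) {ε : ℝ}
    (hE : interactionEnergy V x ≤ (e + ε) * N) :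
    interactionEnergy U x ≤ ε * N ∧ ∑ i, ∑ j, f (dist (x i) (x j)) ≤ 2 * (ε * N) := by
  have hsplitE := interactionEnergy_eq_add_add_of_injective hsplit hx
  have hEU : 0 ≤ interactionEnergy U x := interactionEnergy_nonneg_of_injective hU hx
  have hB : 0 ≤ ∑ i, ∑ j, f (dist (x i) (x j)) := by
    simpa only [one_mul] using hf N x (fun _ => 1)
  have hdiag := sum_sum_eq_card_mul_add_two_mul_interactionEnergy f x
  have hEg := hstab N x hx
  have hE' : interactionEnergy V x ≤ -(c * N) - N * f 0 / 2 + ε * N := by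
    have : (e + ε) * N = -(c * N) - N * f 0 / 2 + ε * N := by
      rw [show e = -(c + f 0 / 2) by linarith]; ring
    linarith [hE, this]
  constructor
  · linarith
  · linarith

/-- `TrialStateUpper` at `Q = P` read on ground states: for every `ε > 0`, eventually
`𝓔(x^N) = E(N) ≤ (e(P) + ε) N`. [folklore] -/
theorem eventually_energy_le (hT : BraggSlacknessRigidity.TrialStateUpper)
    (P : PeriodicConfiguration 3) {x : (N : ℕ) → (Fin N → EuclideanSpace ℝ (Fin 3))}
    (hx : ∀ N, IsGroundState lennardJones (x N)) {ε : ℝ} (hε : 0 < ε) :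
    ∀ᶠ N : ℕ in atTop,
      interactionEnergy lennardJones (x N) ≤ (P.energyPerParticle lennardJones + ε) * N := by
  filter_upwards [hT P ε hε, eventually_gt_atTop 0] with N hN hN0
  have hNpos : (0 : ℝ) < N := by exact_mod_cast hN0
  rwa [← (hx N).2, div_le_iff₀ hNpos] at hN

/-! ## (S2): counting pairs at non-template distances -/

/-- If `U ≥ m` on the distances of the ordered pairs `i ≠ j` satisfying `Q`, and `U ≥ 0` on
`(0,∞)`, then `m · #{(i,j) : i ≠ j, Q(|xᵢ - xⱼ|)} ≤ 2𝓔_U(x)` for injective `x`. [folklore] -/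
theorem card_filter_mul_le {N : ℕ} {x : Fin N → EuclideanSpace ℝ (Fin 3)}
    (hx : Function.Injective x) {U : ℝ → ℝ}
    (hU : ∀ r : ℝ, 0 < r → 0 ≤ U r) (Q : ℝ → Prop) {m : ℝ}
    (hm : ∀ i j : Fin N, i ≠ j → Q (dist (x i) (x j)) → m ≤ U (dist (x i) (x j))) :
    m * (Nat.card {p : Fin N × Fin N // p.1 ≠ p.2 ∧ Q (dist (x p.1) (x p.2))} : ℝ) ≤
      2 * interactionEnergy U x := by
  classical
  set S := (Finset.univ : Finset (Fin N × Fin N)).filter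
    (fun p => p.1 ≠ p.2 ∧ Q (dist (x p.1) (x p.2))) with hS
  have hcard : (Nat.card {p : Fin N × Fin N // p.1 ≠ p.2 ∧ Q (dist (x p.1) (x p.2))} : ℝ) =
      S.card := by
    rw [Nat.card_eq_fintype_card, Fintype.card_subtype]
  rw [hcard, two_mul_interactionEnergy_eq_sum_offDiag U x]
  calc m * (S.card : ℝ) = ∑ _p ∈ S, m := by rw [Finset.sum_const, nsmul_eq_mul, mul_comm]
    _ ≤ ∑ p ∈ S, U (dist (x p.1) (x p.2)) := Finset.sum_le_sum fun p hp => by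
        obtain ⟨hne, hQ⟩ := (Finset.mem_filter.1 hp).2
        exact hm p.1 p.2 hne hQ
    _ ≤ ∑ p ∈ Finset.univ.offDiag, U (dist (x p.1) (x p.2)) := by
        refine Finset.sum_le_sum_of_subset_of_nonneg (fun p hp => ?_) (fun p hp _ => ?_)
        · have hne : p.1 ≠ p.2 := ((Finset.mem_filter.1 hp).2).1
          simp [Finset.mem_offDiag, hne]
        · have hne : p.1 ≠ p.2 := (Finset.mem_offDiag.1 hp).2.2
          exact hU _ (dist_pos.2 fun h => hne (hx h))

/-- **(S2) from the `U`-slack.** Under a strict certificate and `TrialStateUpper`, along ground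
states with hard core `δ`, for every range `R` and tolerance `η > 0` the number of ordered pairs
`i ≠ j` with `|xᵢ - xⱼ| ≤ R` at distance `η`-far from the distance set of `P` is `o(N)`.
[folklore] -/
theorem farPairs_tendsto_zero (hT : BraggSlacknessRigidity.TrialStateUpper)
    {P : PeriodicConfiguration 3} {c : ℝ} {g U f : ℝ → ℝ}
    (hsplit : ∀ r : ℝ, 0 < r → lennardJones r = g r + U r + f r)
    (hU : ∀ r : ℝ, 0 < r → 0 ≤ U r)
    (hf : ∀ (n : ℕ) (y : Fin n → EuclideanSpace ℝ (Fin 3)) (w : Fin n → ℝ),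
      0 ≤ ∑ i, ∑ j, w i * w j * f (dist (y i) (y j)))
    (hstab : ∀ (N : ℕ) (x : Fin N → EuclideanSpace ℝ (Fin 3)), Function.Injective x →
      -(c * (N : ℝ)) ≤ interactionEnergy g x)
    (hc : c + f 0 / 2 = -(P.energyPerParticle lennardJones))
    (hUc : ContinuousOn U (Set.Ioi 0))
    (hUz : ∀ r : ℝ, 0 < r → U r = 0 → ∃ a ∈ P.points, ∃ b ∈ P.points, r = dist a b)
    {δ : ℝ} (hδ : 0 < δ) {x : (N : ℕ) → (Fin N → EuclideanSpace ℝ (Fin 3))}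
    (hx : ∀ N, IsGroundState lennardJones (x N))
    (hsepx : ∀ (N : ℕ) (i j : Fin N), i ≠ j → δ ≤ dist (x N i) (x N j))
    (R η : ℝ) (hη : 0 < η) :
    Tendsto (fun N : ℕ => (Nat.card {p : Fin N × Fin N // p.1 ≠ p.2 ∧
      dist (x N p.1) (x N p.2) ≤ R ∧ ∀ a ∈ P.points, ∀ b ∈ P.points,
        η ≤ |dist (x N p.1) (x N p.2) - dist a b|} : ℝ) / N) atTop (𝓝 0) := by
  -- the compact set of admissible "far" distances
  set C : Set ℝ := ⋂ a ∈ P.points, ⋂ b ∈ P.points, {r : ℝ | η ≤ |r - dist a b|} with hCdef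
  set K : Set ℝ := Set.Icc δ R ∩ C with hKdef
  have hCclosed : IsClosed C := by
    refine isClosed_biInter fun a _ => isClosed_biInter fun b _ => ?_
    exact isClosed_le continuous_const (by fun_prop)
  have hKc : IsCompact K := isCompact_Icc.inter_right hCclosed
  have hKsub : K ⊆ Set.Ioi 0 := fun r hr => hδ.trans_le hr.1.1
  have hKpos : ∀ r ∈ K, 0 < U r := by
    rintro r ⟨⟨hr1, -⟩, hrC⟩
    have hr : 0 < r := hδ.trans_le hr1
    refine lt_of_le_of_ne (hU r hr) fun h0 => ?_
    obtain ⟨a, ha, b, hb, hab⟩ := hUz r hr h0.symm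
    have h1 : r ∈ ⋂ b ∈ P.points, {r : ℝ | η ≤ |r - dist a b|} := Set.mem_iInter₂.1 hrC a ha
    have h2 : r ∈ {r : ℝ | η ≤ |r - dist a b|} := Set.mem_iInter₂.1 h1 b hb
    rw [Set.mem_setOf_eq, hab, sub_self, abs_zero] at h2
    exact absurd h2 (not_le.2 hη)
  obtain ⟨m, hm, hmin⟩ := exists_pos_forall_le_of_isCompact hKc (hUc.mono hKsub) hKpos
  apply tendsto_zero_of_abs_eventually_le
  intro ε hε
  have hε₁ : 0 < ε * m / 2 := by positivity
  filter_upwards [eventually_energy_le hT P hx hε₁, eventually_gt_atTop 0] with N hN hN0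
  have hNpos : (0 : ℝ) < N := by exact_mod_cast hN0
  obtain ⟨hEU, -⟩ := slack_bounds hsplit hU hf hstab hc (hx N).1 hN
  have hcard : m * (Nat.card {p : Fin N × Fin N // p.1 ≠ p.2 ∧
      dist (x N p.1) (x N p.2) ≤ R ∧ ∀ a ∈ P.points, ∀ b ∈ P.points,
        η ≤ |dist (x N p.1) (x N p.2) - dist a b|} : ℝ) ≤ 2 * interactionEnergy U (x N) :=
    card_filter_mul_le (hx N).1 hU
      (fun r => r ≤ R ∧ ∀ a ∈ P.points, ∀ b ∈ P.points, η ≤ |r - dist a b|)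
      (fun i j hij hQ => hmin _ ⟨⟨hsepx N i j hij, hQ.1⟩, by
        simp only [hCdef, Set.mem_iInter, Set.mem_setOf_eq]
        exact hQ.2⟩)
  rw [abs_div, abs_of_pos hNpos, div_le_iff₀ hNpos, abs_of_nonneg (Nat.cast_nonneg _)]
  have h1 : m * (Nat.card {p : Fin N × Fin N // p.1 ≠ p.2 ∧
      dist (x N p.1) (x N p.2) ≤ R ∧ ∀ a ∈ P.points, ∀ b ∈ P.points,
        η ≤ |dist (x N p.1) (x N p.2) - dist a b|} : ℝ) ≤ m * (ε * N) := by
    calc _ ≤ 2 * interactionEnergy U (x N) := hcard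
      _ ≤ 2 * (ε * m / 2 * N) := by linarith [hEU]
      _ = m * (ε * N) := by ring
  exact le_of_mul_le_mul_left h1 hm

/-! ## (S3): the structure factor off the Bragg spheres -/

/-- **(S3) from the `f̂`-slack.** Under a strict certificate and `TrialStateUpper`, along ground
states, `(1/N) ∫ h |S_N|² → 0` for every continuous compactly supported `h` whose support avoids
`0` and the Bragg spheres of `P` (there `𝓕F > 0`). [folklore] -/
theorem structureFactor_tendsto_zero (hT : BraggSlacknessRigidity.TrialStateUpper)
    {P : PeriodicConfiguration 3} {c : ℝ} {g U f : ℝ → ℝ}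
    (hsplit : ∀ r : ℝ, 0 < r → lennardJones r = g r + U r + f r)
    (hU : ∀ r : ℝ, 0 < r → 0 ≤ U r)
    (hf : ∀ (n : ℕ) (y : Fin n → EuclideanSpace ℝ (Fin 3)) (w : Fin n → ℝ),
      0 ≤ ∑ i, ∑ j, w i * w j * f (dist (y i) (y j)))
    (hstab : ∀ (N : ℕ) (x : Fin N → EuclideanSpace ℝ (Fin 3)), Function.Injective x →
      -(c * (N : ℝ)) ≤ interactionEnergy g x)
    (hc : c + f 0 / 2 = -(P.energyPerParticle lennardJones))
    (hFc : Continuous fun v : EuclideanSpace ℝ (Fin 3) => (f ‖v‖ : ℂ))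
    (hFi : Integrable fun v : EuclideanSpace ℝ (Fin 3) => (f ‖v‖ : ℂ))
    (hFF : Integrable (𝓕 fun v : EuclideanSpace ℝ (Fin 3) => (f ‖v‖ : ℂ)))
    (hFpos : ∀ ξ : EuclideanSpace ℝ (Fin 3),
      (𝓕 (fun v : EuclideanSpace ℝ (Fin 3) => (f ‖v‖ : ℂ)) ξ).im = 0 ∧
      0 ≤ (𝓕 (fun v : EuclideanSpace ℝ (Fin 3) => (f ‖v‖ : ℂ)) ξ).re)
    (hFne : ∀ ξ : EuclideanSpace ℝ (Fin 3), ξ ≠ 0 →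
      (∀ k : EuclideanSpace ℝ (Fin 3),
        (∀ g ∈ P.lattice, ∃ n : ℤ, inner ℝ k g = (n : ℝ)) → ‖ξ‖ ≠ ‖k‖) →
        𝓕 (fun v : EuclideanSpace ℝ (Fin 3) => (f ‖v‖ : ℂ)) ξ ≠ 0)
    {x : (N : ℕ) → (Fin N → EuclideanSpace ℝ (Fin 3))}
    (hx : ∀ N, IsGroundState lennardJones (x N))
    (h : EuclideanSpace ℝ (Fin 3) → ℝ) (hhc : Continuous h) (hhs : HasCompactSupport h)
    (hsupp : ∀ ξ ∈ tsupport h, ξ ≠ 0 ∧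
      ∀ k : EuclideanSpace ℝ (Fin 3),
        (∀ g ∈ P.lattice, ∃ n : ℤ, inner ℝ k g = (n : ℝ)) → ‖ξ‖ ≠ ‖k‖) :
    Tendsto (fun N : ℕ => (∫ ξ, h ξ *
      ‖∑ j : Fin N, Complex.exp (2 * Real.pi * Complex.I * (inner ℝ ξ (x N j) : ℂ))‖ ^ 2) / N)
      atTop (𝓝 0) := by
  set F : EuclideanSpace ℝ (Fin 3) → ℂ := fun v => (f ‖v‖ : ℂ) with hFdef
  -- a positive sup bound for `h`
  obtain ⟨M₀, hM₀⟩ := hhc.bounded_above_of_compact_support hhs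
  set M : ℝ := M₀ + 1 with hMdef
  have hM : ∀ ξ, ‖h ξ‖ ≤ M := fun ξ => (hM₀ ξ).trans (by rw [hMdef]; linarith)
  have hMpos : 0 < M := by
    have := (norm_nonneg _).trans (hM₀ 0)
    rw [hMdef]; linarith
  -- a positive lower bound for `Re 𝓕F` on `tsupport h`
  have hcont : ContinuousOn (fun ξ : EuclideanSpace ℝ (Fin 3) => (𝓕 F ξ).re) (tsupport h) :=
    (Complex.continuous_re.comp (continuous_fourier' hFi)).continuousOn
  have hpos : ∀ ξ ∈ tsupport h, 0 < (𝓕 F ξ).re := by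
    intro ξ hξ
    obtain ⟨hξ0, hξk⟩ := hsupp ξ hξ
    have hne := hFne ξ hξ0 hξk
    rcases (hFpos ξ).2.lt_or_eq with hlt | heq
    · exact hlt
    · refine absurd (Complex.ext ?_ ?_) hne
      · simpa using heq.symm
      · simpa using (hFpos ξ).1
  obtain ⟨m, hm, hmin⟩ := exists_pos_forall_le_of_isCompact hhs hcont hpos
  apply tendsto_zero_of_abs_eventually_le
  intro ε hε
  have hε₁ : 0 < ε * m / (2 * M) := by positivity
  filter_upwards [eventually_energy_le hT P hx hε₁, eventually_gt_atTop 0] with N hN hN0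
  have hNpos : (0 : ℝ) < N := by exact_mod_cast hN0
  obtain ⟨-, hfsum⟩ := slack_bounds hsplit hU hf hstab hc (hx N).1 hN
  rw [sum_sum_radial_eq_integral hFc hFi hFF (x N)] at hfsum
  have hb := abs_integral_sf_le hFF (fun ξ => (hFpos ξ).2) hM hm hmin (x N)
  rw [abs_div, abs_of_pos hNpos, div_le_iff₀ hNpos]
  calc |∫ ξ : EuclideanSpace ℝ (Fin 3), h ξ *
        ‖∑ j : Fin N, Complex.exp (2 * Real.pi * Complex.I * (inner ℝ ξ (x N j) : ℂ))‖ ^ 2|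
      ≤ M / m * ∫ ξ : EuclideanSpace ℝ (Fin 3), (𝓕 F ξ).re *
          ‖∑ j, Complex.exp (2 * Real.pi * Complex.I * (⟪ξ, x N j⟫ : ℂ))‖ ^ 2 := hb
    _ ≤ M / m * (2 * (ε * m / (2 * M) * N)) :=
        mul_le_mul_of_nonneg_left hfsum (div_nonneg hMpos.le hm.le)
    _ = ε * N := by field_simp

end BraggSlacknessTransfer

open BraggSlacknessTransfer in
/-- Settles `stmt-AtomisticToContinuum-13170` (`BraggSlacknessRigidity.SlacknessTransfer`):
**two-sided complementary slackness** — a strict hcp certificate, the trial-state upper bound,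
the uniform hard core of Lennard-Jones ground states and hcp diffraction rigidity together give
`IsCrystallizing lennardJones 3`.  The certificate's `U`-slack yields (S2)
(`farPairs_tendsto_zero`), its `f̂`-slack yields (S3) (`structureFactor_tendsto_zero`), the hard
core is `LennardJonesMinimalDistance`, and `HcpDiffractionRigidity` at the certificate's template
returns the conclusion of `IsCrystallizing` verbatim. -/
theorem slacknessTransfer_proof : BraggSlacknessRigidity.SlacknessTransfer := by
  unfold BraggSlacknessRigidity.SlacknessTransfer
  rintro ⟨P, ρ, c, g, U, f, hP, hsplit, hU, -, hf, hstab, hc, hUc, hUz, hFc, hFi, hFF, hFpos,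
    hFne⟩ hT ⟨δ, hδ, hsep⟩ hR x hx
  have hsepx : ∀ (N : ℕ) (i j : Fin N), i ≠ j → δ ≤ dist (x N i) (x N j) :=
    fun N i j hij => hsep N (x N) (hx N) i j hij
  exact hR P hP δ hδ x hsepx
    (fun R η hη => farPairs_tendsto_zero hT hsplit hU hf hstab hc hUc hUz hδ hx hsepx R η hη)
    (fun h hhc hhs hsupp => structureFactor_tendsto_zero hT hsplit hU hf hstab hc hFc hFi hFF
      hFpos hFne hx h hhc hhs hsupp)

end Summit.AtomisticToContinuum.Crystallization.Theorems

end
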